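import Summits.QuantumFields.YangMills.Theorems.ColdStartUniversalityLatticeLangevinWilsonPoincare
import HarnessLib

/-!
# Route `ColdStartUniversality` (fixed-cut-off `L²(μ_{β'})` package): `L²` DECAY AT RATE `λ` ⇒ GENERATOR-FORM POINCARÉ WITH THE
# SAME CONSTANT `λ` on all `C³` cylinder functions (the converse of `…WilsonGeneratorPoincare`, matched constants)

Helper file (seat `ym-line-csu-p1`, g18; `--supports stmt-QuantumFields-27363`).  g16's `wilson_poincare` derives the generator-form
Poincaré inequality from the spectral gap with the Doeblin rate (an EXISTENTIAL constant).  Here the same localisation argument is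
run against a decay HYPOTHESIS with a GIVEN rate `λ` for one realising kernel family:

* ★ `generatorPoincare_of_integral_sq_transition_sub_le_exp` — if `∫ (κ_t G − μG)² dμ_{β'} ≤ e^{−2λt} Var_μ(G)` for all continuous
  `G` and all `t`, then `λ ∫ (F − μF)² dμ_{β'} ≤ −∫ (F − μF) 𝓛f dμ_{β'}` for EVERY `C³` `f`, `F = f∘coords` (no compact support
  needed: bump `≡ 1` near the group; `⟨G, κ_τG⟩ = ‖κ_{τ/2}G‖² ≤ e^{−λτ}‖G‖²` for centred `G`, differentiated at `τ = 0⁺` by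
  `tendsto_dirichletForm_semigroup`).

With `generatorPoincare_implies_decay` (g18) the two typings «generator-form Poincaré(λ) on C³ cylinders» and «L² decay at rate λ
for continuous observables» are EQUIVALENT at every fixed cut-off, with the same `λ` (Bakry–Gentil–Ledoux Thm 4.2.5 (i)⇔(ii) for
this diffusion).  THEOREMS ONLY, no definition, no sorry.  HONEST FRAMING: fixed-cut-off plumbing; nothing K-uniform is proved; no
crux, rung or summit statement is proved; the Yang–Mills mass gap is NOT proved.
-/

set_option autoImplicit false

noncomputable section

namespace Summit.QuantumFields.YangMills.Theorems.ColdStartUniversality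

open MeasureTheory ProbabilityTheory Finset Filter Set Topology Metric
open scoped BigOperators NNReal ENNReal
open Literature.Probability.Process Literature.MathematicalPhysics.QuantumFieldTheory
open Literature.MathematicalPhysics.QuantumLattice (fundamentalRep fundamentalLatticeRep continuous_fundamentalRep)

variable {L : ℕ} [NeZero L]

/-- ★ **`L²(μ_{β'})` decay at rate `λ` ⇒ generator-form Poincaré inequality with constant `λ`** for every `C³` function `f` of the
real link coordinates (`F = f∘coords`, `m = μF`): `λ ∫ (F − m)² dμ_{β'} ≤ −∫ (F − m) 𝓛f dμ_{β'}`.  Proof as in `wilson_poincare`: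
`F − m = g∘coords` with `g = χ(f − m)` compactly supported, `𝓛g = 𝓛f` on the group; for the centred `G = g∘coords`,
`⟨G, κ_τ G⟩_μ = ‖κ_{τ/2} G‖²_μ ≤ e^{−λτ} ‖G‖²_μ` by the hypothesis, and `τ⁻¹(⟨G, κ_τG⟩ − ‖G‖²) → ∫ G 𝓛g dμ`
(`tendsto_dirichletForm_semigroup`) is compared with `τ⁻¹(e^{−λτ} − 1)‖G‖² → −λ‖G‖²`. [cite: BakryGentilLedoux2014, Thm 4.2.5] -/
theorem generatorPoincare_of_integral_sq_transition_sub_le_exp (L : ℕ) [NeZero L] (β' : ℝ)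
    (κ : ℝ≥0 → Kernel (GaugeConfig 3 L (Matrix.specialUnitaryGroup (Fin 2) ℂ))
      (GaugeConfig 3 L (Matrix.specialUnitaryGroup (Fin 2) ℂ))) [∀ t, IsMarkovKernel (κ t)]
    (hreal : ∀ (t : ℝ≥0) (x : GaugeConfig 3 L (Matrix.specialUnitaryGroup (Fin 2) ℂ))
        (Ω : Type) [MeasurableSpace Ω] (P : Measure Ω) [IsProbabilityMeasure P]
        (W : ℝ≥0 → Ω → (Edge 3 L × NoiseIdx 2 → ℝ)) (hW : IsFlatBrownian W P)
        (U : ℝ≥0 → Ω → GaugeConfig 3 L (Matrix.specialUnitaryGroup (Fin 2) ℂ)),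
        (∀ ω, U 0 ω = x) →
        (latticeLangevinDynamics (fundamentalLatticeRep 2) β').IsSolution (fundamentalRep (Fin 2))
          hW.natFiltration P W U →
        κ t x = P.map (U t))
    {lam : ℝ}
    (hdecay : ∀ (G : GaugeConfig 3 L (Matrix.specialUnitaryGroup (Fin 2) ℂ) → ℝ), Continuous G → ∀ t : ℝ≥0,
      ∫ x, ((∫ y, G y ∂(κ t x)) - ∫ z, G z ∂(wilsonMeasure (d := 3) (L := L) (fundamentalRep (Fin 2)) β')) ^ 2
          ∂(wilsonMeasure (d := 3) (L := L) (fundamentalRep (Fin 2)) β') ≤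
        Real.exp (-2 * lam * t) *
          ∫ x, (G x - ∫ z, G z ∂(wilsonMeasure (d := 3) (L := L) (fundamentalRep (Fin 2)) β')) ^ 2
            ∂(wilsonMeasure (d := 3) (L := L) (fundamentalRep (Fin 2)) β'))
    (f : (Edge 3 L × Fin 2 × Fin 2 × Bool → ℝ) → ℝ) (hf : ContDiff ℝ 3 f) :
    let coords : GaugeConfig 3 L (Matrix.specialUnitaryGroup (Fin 2) ℂ) → (Edge 3 L × Fin 2 × Fin 2 × Bool → ℝ) :=
      fun V q => (fun z : ℂ => if q.2.2.2 then z.im else z.re)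
        ((fundamentalRep (Fin 2) (V q.1) : Matrix (Fin 2) (Fin 2) ℂ) q.2.1 q.2.2.1)
    let gen : GaugeConfig 3 L (Matrix.specialUnitaryGroup (Fin 2) ℂ) → ℝ := fun V =>
      (∑ i : Edge 3 L × Fin 2 × Fin 2 × Bool, fderiv ℝ f (coords V) (Pi.single i 1) *
          (fun z : ℂ => if i.2.2.2 then z.im else z.re)
            ((latticeLangevinDynamics (fundamentalLatticeRep 2) β').drift
              (matrixConfig (fundamentalRep (Fin 2)) V) i.1 i.2.1 i.2.2.1) +
      1 / 2 * ∑ i : Edge 3 L × Fin 2 × Fin 2 × Bool, ∑ j : Edge 3 L × Fin 2 × Fin 2 × Bool,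
        fderiv ℝ (fun z => fderiv ℝ f z (Pi.single i 1)) (coords V) (Pi.single j 1) *
          ∑ n : Edge 3 L × NoiseIdx 2,
            (if n.1 = i.1 then (fun z : ℂ => if i.2.2.2 then z.im else z.re)
              ((latticeLangevinDynamics (fundamentalLatticeRep 2) β').noise
                (matrixConfig (fundamentalRep (Fin 2)) V) i.1 n.2 i.2.1 i.2.2.1) else 0) *
            (if n.1 = j.1 then (fun z : ℂ => if j.2.2.2 then z.im else z.re)
              ((latticeLangevinDynamics (fundamentalLatticeRep 2) β').noise
                (matrixConfig (fundamentalRep (Fin 2)) V) j.1 n.2 j.2.1 j.2.2.1) else 0))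
    lam * ∫ V, (f (coords V) - ∫ V', f (coords V') ∂(wilsonMeasure (d := 3) (L := L) (fundamentalRep (Fin 2)) β')) ^ 2
        ∂(wilsonMeasure (d := 3) (L := L) (fundamentalRep (Fin 2)) β') ≤
      -∫ V, (f (coords V) - ∫ V', f (coords V') ∂(wilsonMeasure (d := 3) (L := L) (fundamentalRep (Fin 2)) β')) *
        gen V ∂(wilsonMeasure (d := 3) (L := L) (fundamentalRep (Fin 2)) β') := by
  intro coords gen
  classical
  haveI := secondCountableTopology_su2
  haveI := borelSpace_config L
  haveI : IsProbabilityMeasure (wilsonMeasure (d := 3) (L := L) (fundamentalRep (Fin 2)) β') :=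
    isProbabilityMeasure_wilsonMeasure (d := 3) (L := L) (fundamentalRep (Fin 2)) (continuous_fundamentalRep (Fin 2)) β'
  set μ : Measure (GaugeConfig 3 L (Matrix.specialUnitaryGroup (Fin 2) ℂ)) :=
    wilsonMeasure (d := 3) (L := L) (fundamentalRep (Fin 2)) β' with hμ
  -- the centred observable as a compactly supported cylinder function: `g = χ · (f − m)`
  set m : ℝ := ∫ V', f (coords V') ∂μ with hm
  let χ : ContDiffBump (0 : (Edge 3 L × Fin 2 × Fin 2 × Bool) → ℝ) := ⟨2, 3, by norm_num, by norm_num⟩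
  set g : ((Edge 3 L × Fin 2 × Fin 2 × Bool) → ℝ) → ℝ := fun y =>
    (χ : ((Edge 3 L × Fin 2 × Fin 2 × Bool) → ℝ) → ℝ) y * (f y - m) with hgdef
  have hg : ContDiff ℝ 3 g := χ.contDiff.mul (hf.sub contDiff_const)
  have hgc : HasCompactSupport g := χ.hasCompactSupport.mul_right
  have hball : ∀ V : GaugeConfig 3 L (Matrix.specialUnitaryGroup (Fin 2) ℂ),
      coords V ∈ ball (0 : (Edge 3 L × Fin 2 × Fin 2 × Bool) → ℝ) 2 := by
    intro V
    rw [mem_ball, dist_zero_right]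
    exact (norm_coords_le_one V).trans_lt (by norm_num)
  have hEq : ∀ y ∈ ball (0 : (Edge 3 L × Fin 2 × Fin 2 × Bool) → ℝ) 2, g y = f y + (-m) := by
    intro y hy
    have h1 : (χ : ((Edge 3 L × Fin 2 × Fin 2 × Bool) → ℝ) → ℝ) y = 1 :=
      χ.one_of_mem_closedBall (ball_subset_closedBall hy)
    simp only [hgdef, h1, one_mul, sub_eq_add_neg]
  have hgF : ∀ V, g (coords V) = f (coords V) - m := fun V => by rw [hEq _ (hball V), ← sub_eq_add_neg]
  -- `𝓛g = 𝓛f` on the group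
  set geng : GaugeConfig 3 L (Matrix.specialUnitaryGroup (Fin 2) ℂ) → ℝ := fun V =>
    (∑ i : Edge 3 L × Fin 2 × Fin 2 × Bool, fderiv ℝ g (coords V) (Pi.single i 1) *
        (fun z : ℂ => if i.2.2.2 then z.im else z.re)
          ((latticeLangevinDynamics (fundamentalLatticeRep 2) β').drift
            (matrixConfig (fundamentalRep (Fin 2)) V) i.1 i.2.1 i.2.2.1) +
    1 / 2 * ∑ i : Edge 3 L × Fin 2 × Fin 2 × Bool, ∑ j : Edge 3 L × Fin 2 × Fin 2 × Bool,
      fderiv ℝ (fun z => fderiv ℝ g z (Pi.single i 1)) (coords V) (Pi.single j 1) *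
        ∑ n : Edge 3 L × NoiseIdx 2,
          (if n.1 = i.1 then (fun z : ℂ => if i.2.2.2 then z.im else z.re)
            ((latticeLangevinDynamics (fundamentalLatticeRep 2) β').noise
              (matrixConfig (fundamentalRep (Fin 2)) V) i.1 n.2 i.2.1 i.2.2.1) else 0) *
          (if n.1 = j.1 then (fun z : ℂ => if j.2.2.2 then z.im else z.re)
            ((latticeLangevinDynamics (fundamentalLatticeRep 2) β').noise
              (matrixConfig (fundamentalRep (Fin 2)) V) j.1 n.2 j.2.1 j.2.2.1) else 0)) with hgengdef
  have hgen : ∀ V, geng V = gen V := by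
    intro V
    simp only [hgengdef, gen, fderiv_eq_of_eqOn_ball hEq (hball V), fderiv_fderiv_eq_of_eqOn_ball hEq (hball V)]
  -- the objects of the limit
  set G : GaugeConfig 3 L (Matrix.specialUnitaryGroup (Fin 2) ℂ) → ℝ := fun V => g (coords V) with hGdef
  have hGc : Continuous G := hg.continuous.comp (continuous_coords (L := L))
  set φ₀ : ℝ := ∫ V, G V * G V ∂μ with hφ₀
  set d : ℝ := ∫ V, G V * geng V ∂μ with hd
  have hG0 : ∫ V, G V ∂μ = 0 := by
    have hFi : Integrable (fun V => f (coords V)) μ :=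
      integrable_of_continuous_of_compactSpace (hf.continuous.comp (continuous_coords (L := L))) μ
    simp_rw [hGdef, hgF]
    rw [integral_sub hFi (integrable_const m)]
    simp [hm]
  -- the Dirichlet form of the semigroup on `g`
  have hs : Tendsto (fun τ : ℝ => τ⁻¹ * ((∫ V, G V * (∫ y, G y ∂(κ τ.toNNReal V)) ∂μ) - φ₀)) (𝓝[>] 0) (𝓝 d) :=
    tendsto_dirichletForm_semigroup L β' κ hreal hg hgc
  -- the decay along `τ ↓ 0`: `⟨G, κ_τ G⟩ = ‖κ_{τ/2} G‖² ≤ e^{-λτ} ‖G‖²`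
  have hexp : Tendsto (fun τ : ℝ => τ⁻¹ * ((Real.exp (-lam * τ) - 1) * φ₀)) (𝓝[>] 0) (𝓝 (-lam * φ₀)) := by
    have hD : HasDerivAt (fun τ : ℝ => Real.exp (-lam * τ) * φ₀) (-lam * φ₀) 0 := by
      have h1 : HasDerivAt (fun τ : ℝ => -lam * τ) (-lam) 0 := by
        simpa using (hasDerivAt_id (0 : ℝ)).const_mul (-lam)
      have h2 := (h1.exp).mul_const φ₀
      simpa using h2
    have h := hD.tendsto_slope_zero_right
    refine h.congr' (Eventually.of_forall fun τ => ?_)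
    simp only [zero_add, mul_zero, Real.exp_zero, one_mul, smul_eq_mul]
    ring
  have hle : ∀ᶠ τ in 𝓝[>] (0 : ℝ),
      τ⁻¹ * ((∫ V, G V * (∫ y, G y ∂(κ τ.toNNReal V)) ∂μ) - φ₀) ≤ τ⁻¹ * ((Real.exp (-lam * τ) - 1) * φ₀) := by
    filter_upwards [self_mem_nhdsWithin] with τ hτ
    have hτ' : (0 : ℝ) < τ := hτ
    -- `⟨G, κ_τ G⟩ = ∫ (κ_{τ/2} G)²`
    have hhalf : (τ / 2).toNNReal + (τ / 2).toNNReal = τ.toNNReal := by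
      rw [← Real.toNNReal_add (by positivity) (by positivity), add_halves]
    have hsq := integral_mul_transition_self_eq_sq L β' κ hreal (τ / 2).toNNReal hGc
    rw [hhalf] at hsq
    -- the decay hypothesis at time `τ/2` for the centred `G`
    have hdec := hdecay G hGc (τ / 2).toNNReal
    simp only [hG0, sub_zero, Real.coe_toNNReal _ (show (0 : ℝ) ≤ τ / 2 by positivity)] at hdec
    have e1 : ∫ x, (G x) ^ 2 ∂μ = φ₀ := integral_congr_ae (Eventually.of_forall fun x => by simp only [sq])
    have e2 : -2 * lam * (τ / 2) = -lam * τ := by ring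
    rw [e1, e2] at hdec
    have h : ∫ V, G V * (∫ y, G y ∂(κ τ.toNNReal V)) ∂μ ≤ Real.exp (-lam * τ) * φ₀ := by rw [hsq]; exact hdec
    refine mul_le_mul_of_nonneg_left ?_ (inv_nonneg.2 hτ'.le)
    linarith [h]
  have hdle : d ≤ -lam * φ₀ := le_of_tendsto_of_tendsto hs hexp hle
  -- read back on `f`
  have hφ₀' : φ₀ = ∫ V, (f (coords V) - m) ^ 2 ∂μ := by
    simp only [hφ₀, hGdef, hgF, sq]
  have hd' : d = ∫ V, (f (coords V) - m) * gen V ∂μ := by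
    simp only [hd, hGdef, hgF, hgen]
  rw [← hφ₀', ← hd']
  linarith

end Summit.QuantumFields.YangMills.Theorems.ColdStartUniversality

end
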